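import Literature.Computability.AlgebraicComplexity.LaserMethodTypeCount
import Literature.Computability.AlgebraicComplexity.LaserMethodBlocks
import Literature.Computability.AlgebraicComplexity.LaserValueProducts
import HarnessLib

/-!
# The laser method with values and the penalty `Γ_S(P)` (Le Gall 2014, Thm. 4.1) — proved

Topic `Literature/Computability/AlgebraicComplexity`.  F. Le Gall, *Powers of tensors and fast
matrix multiplication* (ISSAC 2014, arXiv:1401.7714), Thm. 4.1 (p. 6):

> **Theorem 4.1.** Let `t` be a trilinear form, and `D` be a decomposition of `t` with tight
> support `S ⊆ ℤ × ℤ × ℤ` and component set `{t(s)}_{s∈S}`. Then, for any `P ∈ D(S)` and any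
> `ρ ∈ [2,3]`, `log(V_ρ(t)) ≥ ∑_{ℓ=1}^{3} H(P_ℓ)/3 + ∑_{s∈S} P(s) log(V_ρ(t(s))) − Γ_S(P)`.

Here `Γ_S(P) = max_Q H(Q) − H(P)` over the distributions `Q` on `S` with the marginals of `P`
(Le Gall §3; the tree's `maxEntropyPenalty S P`, `MaxEntropyGivenMarginals.lean`), and `V_ρ` is
the value (the tree's predicate `HasLaserValue ρ t v`, "`V_ρ(t) ≥ v`", `LaserValue.lean`).  "This
theorem can be seen as a generalized statement of the approach developed by Coppersmith and
Winograd … the simpler case where each component is isomorphic to a matrix product (which removes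
the need for the term `−Γ_S(P)`) can be found in [BCS]" (p. 6) — that case is `BCS1997_thm1541`
(`LaserMethodTheorem.lean`).

This file PROVES the theorem in the following form (`laserMethod_hasLaserValue`), in the
coordinates of `LaserMethodRestriction.lean`/`LaserMethodBlocks.lean` (a tensor `t : ι → κ → μ → K`
over a field, block labels `bI, bJ, bL`, a `b`-tight finite `S ⊇ supp_D t` — injective
`α, β, γ : · → ℤ^r` with `α i + β j + γ l = 0` on `S`, which contains Le Gall's Def. 3.1
`i + j + l = d` as the case `r = 1` — and components `t(s) = partSubtensor bI bJ bL t {i} {j} {l}`):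
if `V_ρ(t(s)) ≥ v(s) > 0` for all `s ∈ S`, then for every probability distribution `P` on `S`

  `V_ρ(t) ≥ 2^{min_m H(P_m) − Γ_S(P)} · ∏_{s∈S} v(s)^{P(s)}`,

entropies in bits.  The printed average `∑_ℓ H(P_ℓ)/3` is obtained from this `min_m H(P_m)` form by
applying it to `t ⊗ t_C ⊗ t_{C²}` (whose three marginal entropies all equal `∑_ℓ H(P_ℓ)`, Le Gall's
own route, Appendix A.3); for the `S₃`-symmetric distributions of all applications to the
Coppersmith–Winograd tensors the two forms coincide.  No hypothesis `ρ ∈ [2,3]` is needed.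

## Proof (Le Gall, Appendix A, made effective; files `LaserMethodTypeCount.lean`, `LaserMethodBlocks.lean`)

For `P = c/d` and `N = dM` (`laserMethod_hasLaserValue_of_counts`): `Q = Mc`; inside the typed
support `Φ` of the marginal types, the triples `Φ_Q` of joint type `Q` carry a free diagonal `Δ`
(`exists_free_diagonal_jointType_card`, Le Gall Lemma A.2) with
`2^{N(min_m H(P_m) − Γ_S(P))} ≤ |Δ| · J(N)`, `log J(N) = O(log N + √N)`; `t^{⊗N} ≥ |Δ| ⊙ t^{⊗N}(w₀)`
for a word `w₀` of type `Q` (`tensorRestrictsTo_kroneckerPow_multiple_laserBlock`), and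
`V_ρ(t^{⊗N}(w₀)) ≥ ∏_ρ v(w₀(ρ)) = (∏_s v(s)^{P(s)})^N` (supermultiplicativity,
`HasLaserValue.kroneckerPi`), so `V_ρ(t) ≥ (|Δ| W^N)^{1/N}` (`.multiple`, `.of_kroneckerPow`);
choosing `N` with `J(N) ≤ θ^N` for any `θ > 1` (`exists_errTerm_le_mul`) gives every bound below
the claimed one, whence the claim (`hasLaserValue_of_forall_lt`).  A general `P` is the limit of
such `c^{(D)}/D` (`exists_counts_approx`); `min_m H`, `H` and `∏ v^P` are continuous and the
maximum entropy `max_{D(·)} H` is upper semicontinuous along the approximation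
(`maxEntropyGivenMarginals_usc`, compactness of the simplex), which is what Le Gall's "`P` can be
approximated with arbitrary precision by a probability distribution with rational values" needs.

Everything is proved; no definitions, no named facts.

## References

* F. Le Gall, ISSAC 2014, arXiv:1401.7714 (held: `paper:arxiv-1401.7714`): §3 (Defs. 3.1–3.3,
  `Γ_S`), Thm. 4.1 (p. 6), Appendix A (pp. 20–24). [LeGall2014]
* P. Bürgisser, M. Clausen, M. A. Shokrollahi, *Algebraic Complexity Theory* (1997), Thm. 15.41.
  [BurgisserClausenShokrollahi1997]
* D. Coppersmith, S. Winograd, J. Symbolic Comput. 9 (1990), §8. [CoppersmithWinograd1990]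
-/

noncomputable section

open scoped BigOperators
open Finset Filter Topology

namespace Literature.Computability.AlgebraicComplexity

universe u

/-! ## Analysis helpers -/

section Analysis

/-- **Sublinear error terms**: for `a, e, u, v ≥ 0`, `η > 0` and `d ≥ 1` there is a multiple
`N = dM` (`M ≥ 1`) of `d` with `a log(N+1) + e √(u + vN) + w ≤ η N`. [folklore] -/
theorem exists_errTerm_le_mul {a e u v w η : ℝ} (ha : 0 ≤ a) (he : 0 ≤ e) (hu : 0 ≤ u)
    (hv : 0 ≤ v) (hη : 0 < η) {d : ℕ} (hd : 0 < d) :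
    ∃ M : ℕ, 1 ≤ M ∧ a * Real.log (((d * M : ℕ) : ℝ) + 1) + e * √(u + v * ((d * M : ℕ) : ℝ)) + w ≤
      η * ((d * M : ℕ) : ℝ) := by
  set C : ℝ := 2 * √2 * a + e * √(u + v) + max w 0 with hC
  have hC0 : 0 ≤ C := by positivity
  obtain ⟨M₀, hM₀⟩ := exists_nat_ge ((C / η) ^ 2)
  refine ⟨M₀ + 1, by omega, ?_⟩
  set N : ℕ := d * (M₀ + 1) with hN
  have hNM : ((C / η) ^ 2 : ℝ) ≤ N := by
    refine hM₀.trans ?_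
    have : M₀ ≤ N := by rw [hN]; nlinarith
    exact_mod_cast this
  have hN1 : (1 : ℝ) ≤ N := by
    have : 1 ≤ N := by rw [hN]; nlinarith
    exact_mod_cast this
  have hN0 : (0 : ℝ) < N := by linarith
  have hsq1 : 1 ≤ √(N : ℝ) := by rw [← Real.sqrt_one]; exact Real.sqrt_le_sqrt hN1
  -- `C ≤ η √N`
  have hCη : C ≤ η * √(N : ℝ) := by
    have h1 : C / η ≤ √(N : ℝ) := by
      rw [← Real.sqrt_sq (div_nonneg hC0 hη.le)]
      exact Real.sqrt_le_sqrt hNM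
    rwa [div_le_iff₀' hη] at h1
  -- the three terms are `≤ (their constant) · √N`
  have hlog : Real.log ((N : ℝ) + 1) ≤ 2 * √2 * √(N : ℝ) := by
    calc Real.log ((N : ℝ) + 1) ≤ 2 * √((N : ℝ) + 1) := log_le_two_mul_sqrt (by positivity)
      _ ≤ 2 * √(2 * N) := mul_le_mul_of_nonneg_left (Real.sqrt_le_sqrt (by linarith)) (by norm_num)
      _ = 2 * √2 * √(N : ℝ) := by rw [Real.sqrt_mul (by norm_num)]; ring
  have hsqrt : √(u + v * N) ≤ √(u + v) * √(N : ℝ) := by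
    rw [← Real.sqrt_mul (by positivity)]
    refine Real.sqrt_le_sqrt ?_
    nlinarith [mul_nonneg hu hN0.le]
  have hw : w ≤ max w 0 * √(N : ℝ) :=
    (le_max_left w 0).trans (le_mul_of_one_le_right (le_max_right _ _) hsq1)
  calc a * Real.log ((N : ℝ) + 1) + e * √(u + v * N) + w
      ≤ a * (2 * √2 * √(N : ℝ)) + e * (√(u + v) * √(N : ℝ)) + max w 0 * √(N : ℝ) := by
        gcongr
    _ = C * √(N : ℝ) := by rw [hC]; ring
    _ ≤ η * √(N : ℝ) * √(N : ℝ) := mul_le_mul_of_nonneg_right hCη (Real.sqrt_nonneg _)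
    _ = η * N := by rw [mul_assoc, Real.mul_self_sqrt hN0.le]

variable {ι κ μ : Type*} [Fintype ι] [Fintype κ] [Fintype μ]

omit [Fintype ι] in
/-- The first marginal is a continuous function of the distribution. [folklore] -/
theorem continuous_marginalDist₁ : Continuous (marginalDist₁ : (ι × κ × μ → ℝ) → ι → ℝ) :=
  continuous_pi fun _ => continuous_finsetSum _ fun _ _ => continuous_finsetSum _ fun _ _ =>
    continuous_apply _

omit [Fintype κ] in
/-- The second marginal is continuous. [folklore] -/
theorem continuous_marginalDist₂ : Continuous (marginalDist₂ : (ι × κ × μ → ℝ) → κ → ℝ) :=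
  continuous_pi fun _ => continuous_finsetSum _ fun _ _ => continuous_finsetSum _ fun _ _ =>
    continuous_apply _

omit [Fintype μ] in
/-- The third marginal is continuous. [folklore] -/
theorem continuous_marginalDist₃ : Continuous (marginalDist₃ : (ι × κ × μ → ℝ) → μ → ℝ) :=
  continuous_pi fun _ => continuous_finsetSum _ fun _ _ => continuous_finsetSum _ fun _ _ =>
    continuous_apply _

/-- **Upper semicontinuity of the maximum entropy with prescribed marginals** along a convergent
sequence of distributions supported in `Φ`: `limsup_D max_{D(P_D)} H ≤ max_{D(P₀)} H`
(near-maximisers `Q_D ∈ D(P_D)` have a convergent subsequence in the compact simplex, whose limit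
lies in `D(P₀)` because support and marginal conditions are closed and the marginals of `P_D`
converge to those of `P₀`; the entropy is continuous).  This is the step behind "`P` can be
approximated with arbitrary precision by a probability distribution with rational values" in the
proof of Le Gall's Thm. 4.1. [cite: LeGall2014, Appendix A.3 (first paragraph of the proof)] -/
theorem maxEntropyGivenMarginals_usc (Φ : Finset (ι × κ × μ)) {P : ℕ → ι × κ × μ → ℝ}
    {P₀ : ι × κ × μ → ℝ}
    (hP : ∀ᶠ D in atTop, P D ∈ stdSimplex ℝ (ι × κ × μ) ∧ ∀ x, x ∉ Φ → P D x = 0)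
    (hlim : Tendsto P atTop (𝓝 P₀)) {θ : ℝ} (hθ : 0 < θ) :
    ∀ᶠ D in atTop, maxEntropyGivenMarginals Φ (P D) ≤ maxEntropyGivenMarginals Φ P₀ + θ := by
  by_contra hcon
  have hfreq : ∃ᶠ D in atTop, maxEntropyGivenMarginals Φ P₀ + θ < maxEntropyGivenMarginals Φ (P D) := by
    simpa only [Filter.not_eventually, not_le] using hcon
  obtain ⟨φ, hφmono, hφ⟩ := Filter.extraction_of_frequently_atTop (hfreq.and_eventually hP)
  -- near-maximisers
  have hQ : ∀ k, ∃ Q ∈ sameMarginalsOn Φ (P (φ k)),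
      maxEntropyGivenMarginals Φ P₀ + θ < shannonEntropy Q := by
    intro k
    obtain ⟨hlt, hsimp, hsupp⟩ := hφ k
    have hne : (shannonEntropy '' sameMarginalsOn Φ (P (φ k))).Nonempty :=
      ⟨_, ⟨P (φ k), self_mem_sameMarginalsOn hsimp hsupp, rfl⟩⟩
    obtain ⟨_, ⟨Q, hQ, rfl⟩, hltQ⟩ := exists_lt_of_lt_csSup hne hlt
    exact ⟨Q, hQ, hltQ⟩
  choose Q hQmem hQgt using hQ
  -- a convergent subsequence in the compact simplex
  obtain ⟨Qs, hQs, ψ, hψmono, hψlim⟩ :=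
    (isCompact_stdSimplex ℝ (ι × κ × μ)).tendsto_subseq fun k => (hQmem k).1
  have hPlim : Tendsto (fun k => P (φ (ψ k))) atTop (𝓝 P₀) :=
    hlim.comp (hφmono.comp hψmono).tendsto_atTop
  -- its limit has the marginals of `P₀` and is supported in `Φ`
  have hmem : Qs ∈ sameMarginalsOn Φ P₀ := by
    refine ⟨hQs, fun x hx => ?_, ?_, ?_, ?_⟩
    · have h1 : Tendsto (fun k => Q (ψ k) x) atTop (𝓝 (Qs x)) := (tendsto_pi_nhds.1 hψlim) x
      have h2 : (fun k => Q (ψ k) x) = fun _ => 0 := funext fun k => (hQmem (ψ k)).2.1 x hx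
      rw [h2] at h1
      exact (tendsto_nhds_unique tendsto_const_nhds h1).symm
    · have h1 : Tendsto (fun k => marginalDist₁ (Q (ψ k))) atTop (𝓝 (marginalDist₁ Qs)) :=
        (continuous_marginalDist₁.tendsto _).comp hψlim
      have h2 : Tendsto (fun k => marginalDist₁ (P (φ (ψ k)))) atTop (𝓝 (marginalDist₁ P₀)) :=
        (continuous_marginalDist₁.tendsto _).comp hPlim
      have h3 : (fun k => marginalDist₁ (Q (ψ k))) = fun k => marginalDist₁ (P (φ (ψ k))) :=
        funext fun k => (hQmem (ψ k)).2.2.1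
      rw [h3] at h1
      exact tendsto_nhds_unique h1 h2
    · have h1 : Tendsto (fun k => marginalDist₂ (Q (ψ k))) atTop (𝓝 (marginalDist₂ Qs)) :=
        (continuous_marginalDist₂.tendsto _).comp hψlim
      have h2 : Tendsto (fun k => marginalDist₂ (P (φ (ψ k)))) atTop (𝓝 (marginalDist₂ P₀)) :=
        (continuous_marginalDist₂.tendsto _).comp hPlim
      have h3 : (fun k => marginalDist₂ (Q (ψ k))) = fun k => marginalDist₂ (P (φ (ψ k))) :=
        funext fun k => (hQmem (ψ k)).2.2.2.1
      rw [h3] at h1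
      exact tendsto_nhds_unique h1 h2
    · have h1 : Tendsto (fun k => marginalDist₃ (Q (ψ k))) atTop (𝓝 (marginalDist₃ Qs)) :=
        (continuous_marginalDist₃.tendsto _).comp hψlim
      have h2 : Tendsto (fun k => marginalDist₃ (P (φ (ψ k)))) atTop (𝓝 (marginalDist₃ P₀)) :=
        (continuous_marginalDist₃.tendsto _).comp hPlim
      have h3 : (fun k => marginalDist₃ (Q (ψ k))) = fun k => marginalDist₃ (P (φ (ψ k))) :=
        funext fun k => (hQmem (ψ k)).2.2.2.2
      rw [h3] at h1
      exact tendsto_nhds_unique h1 h2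
  -- contradiction: `H(Qs) ≥ max + θ` but `H(Qs) ≤ max`
  have hH : Tendsto (fun k => shannonEntropy (Q (ψ k))) atTop (𝓝 (shannonEntropy Qs)) :=
    (continuous_shannonEntropy.tendsto _).comp hψlim
  have hge : maxEntropyGivenMarginals Φ P₀ + θ ≤ shannonEntropy Qs :=
    ge_of_tendsto hH (Eventually.of_forall fun k => (hQgt (ψ k)).le)
  have hle : shannonEntropy Qs ≤ maxEntropyGivenMarginals Φ P₀ :=
    shannonEntropy_le_maxEntropyGivenMarginals hmem
  linarith

end Analysis

/-! ## The value of the power from a free diagonal of one joint type -/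

section FixedPower

variable {K : Type u} [Field K]
variable {ι κ μ : Type*} [Fintype ι] [Fintype κ] [Fintype μ] [DecidableEq ι] [DecidableEq κ]
  [DecidableEq μ]
variable {I J L : Type*} [Fintype I] [Fintype J] [Fintype L] [DecidableEq I] [DecidableEq J]
  [DecidableEq L]

/-- **`V_ρ(t^{⊗N}) ≥ |Δ| · V_ρ(t^{⊗N}(w₀))`** for a free diagonal `Δ` all of whose blocks have the
type of the word `w₀` (Le Gall (7)–(8): "`V_ρ(t̂) ≥ |Δ| × …` since the value is superadditive";
here `t^{⊗N} ≥ ⟨|Δ|⟩ ⊗ t^{⊗N}(w₀)` and superadditivity for copies).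
[cite: LeGall2014, Appendix A.3, Eqs. (7)–(8)] -/
theorem hasLaserValue_kroneckerPow_of_free_diagonal_of_block (t : ι → κ → μ → K) (bI : ι → I)
    (bJ : κ → J) (bL : μ → L) (S : Finset (I × J × L))
    (hS : ∀ a b c, t a b c ≠ 0 → (bI a, bJ b, bL c) ∈ S)
    {N : ℕ} (Δ : Finset ((Fin N → I) × (Fin N → J) × (Fin N → L)))
    (hfree : ∀ δ ∈ Δ, ∀ δ' ∈ Δ, ∀ δ'' ∈ Δ, (∀ q, (δ.1 q, δ'.2.1 q, δ''.2.2 q) ∈ S) →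
      δ = δ' ∧ δ' = δ'')
    (w₀ : Fin N → I × J × L) (htype : ∀ δ ∈ Δ, letterCount (labelSeq δ) = letterCount w₀)
    {ρ W : ℝ} (hW : HasLaserValue ρ (laserBlock bI bJ bL t w₀) W) :
    HasLaserValue ρ (kroneckerPow t N) (Δ.card * W) :=
  (hW.multiple Δ.card).of_restrictsTo
    (tensorRestrictsTo_kroneckerPow_multiple_laserBlock t bI bJ bL S hS Δ hfree w₀ htype)

/-- **`V_ρ(t^{⊗N}) ≥ |Δ| · ∏_ρ V_ρ(t(w₀(ρ)))`** — the same with the block bounded by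
supermultiplicativity from the values of the components (Le Gall (5): "`V_ρ(t^{⊗N}(a,b,c)) ≥
∏_ℓ V_ρ(t(a_ℓ,b_ℓ,c_ℓ)) = ∏_s [V_ρ(t(s))]^{N Q(s)}`"). [cite: LeGall2014, Appendix A.3, Eqs. (5)–(8)] -/
theorem hasLaserValue_kroneckerPow_of_free_diagonal (t : ι → κ → μ → K) (bI : ι → I) (bJ : κ → J)
    (bL : μ → L) (S : Finset (I × J × L)) (hS : ∀ a b c, t a b c ≠ 0 → (bI a, bJ b, bL c) ∈ S)
    {N : ℕ} (Δ : Finset ((Fin N → I) × (Fin N → J) × (Fin N → L)))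
    (hfree : ∀ δ ∈ Δ, ∀ δ' ∈ Δ, ∀ δ'' ∈ Δ, (∀ q, (δ.1 q, δ'.2.1 q, δ''.2.2 q) ∈ S) →
      δ = δ' ∧ δ' = δ'')
    (w₀ : Fin N → I × J × L) (htype : ∀ δ ∈ Δ, letterCount (labelSeq δ) = letterCount w₀)
    {ρ : ℝ} (v : I × J × L → ℝ) (hv0 : ∀ q, 0 ≤ v (w₀ q))
    (hval : ∀ q, HasLaserValue ρ
      (partSubtensor bI bJ bL t {(w₀ q).1} {(w₀ q).2.1} {(w₀ q).2.2}) (v (w₀ q))) :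
    HasLaserValue ρ (kroneckerPow t N) (Δ.card * ∏ q, v (w₀ q)) :=
  hasLaserValue_kroneckerPow_of_free_diagonal_of_block t bI bJ bL S hS Δ hfree w₀ htype
    (HasLaserValue.kroneckerPi hval hv0)

omit [Fintype ι] [Fintype κ] [Fintype μ] [DecidableEq ι] [DecidableEq κ] [DecidableEq μ] in
/-- The product of component bounds along a word of type `M c` is the `dM`-th power of
`∏_{s∈S} v(s)^{c(s)/d}` (for `c` supported in `S`, `v > 0` on `S`). [folklore] -/
theorem prod_apply_word_eq_pow (S : Finset (I × J × L)) (v : I × J × L → ℝ) (hv : ∀ s ∈ S, 0 < v s)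
    (c : I × J × L → ℕ) (hcS : ∀ s, s ∉ S → c s = 0) {d : ℕ} (hd : 0 < d) {M : ℕ}
    (w : Fin (d * M) → I × J × L) (hw : letterCount w = fun s => M * c s) :
    ∏ q, v (w q) = (∏ s ∈ S, v s ^ ((c s : ℝ) / d)) ^ (d * M) := by
  classical
  have hd0 : (d : ℝ) ≠ 0 := by exact_mod_cast hd.ne'
  rw [prod_apply_eq_prod_pow_letterCount v w, hw, ← Finset.prod_pow]
  rw [← Finset.prod_subset (Finset.subset_univ S) (fun s _ hs => by
    simp only [hcS s hs, mul_zero, pow_zero])]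
  refine Finset.prod_congr rfl fun s hs => ?_
  rw [← Real.rpow_natCast (v s ^ ((c s : ℝ) / d)) (d * M), ← Real.rpow_mul (hv s hs).le,
    ← Real.rpow_natCast]
  congr 1
  push_cast
  field_simp

end FixedPower

/-! ## The core: distributions with a common denominator, blocks with a value system -/

section Rational

variable {K : Type u} [Field K]
variable {ι κ μ : Type*} [Fintype ι] [Fintype κ] [Fintype μ] [DecidableEq ι] [DecidableEq κ]
  [DecidableEq μ]
variable {I J L : Type*} [Fintype I] [Fintype J] [Fintype L] [DecidableEq I] [DecidableEq J]
  [DecidableEq L]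

/-- **The core of Le Gall Thm. 4.1, for `P = c/d`, with an abstract value bound for the blocks.**
If every block `t^{⊗ dM}(w)` whose label word `w` has type `M c` has value `≥ W^{dM}` (`W > 0`),
then `V_ρ(t) ≥ 2^{min_m H(P_m) − Γ_S(P)} · W`.  (With `W = ∏_s V_ρ(t(s))^{P(s)}` this hypothesis is
supermultiplicativity, Le Gall (5); keeping it abstract lets the symmetrised form of the theorem —
blocks of `t ⊗ t_C ⊗ t_{C²}` — reuse the same core.)  Proof: the free diagonal of type `Mc`
(`exists_free_diagonal_jointType_card`) has `2^{N(min H − Γ)} ≤ |Δ| J(N)` with `log J(N) = o(N)`;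
`V_ρ(t^{⊗N}) ≥ |Δ| W^N`; take `N`-th roots along `N` with `J(N) ≤ θ^N`.
[cite: LeGall2014, Thm. 4.1 (proof, Appendix A.3)] -/
theorem laserMethod_hasLaserValue_of_blockValue (t : ι → κ → μ → K) (bI : ι → I) (bJ : κ → J)
    (bL : μ → L) (S : Finset (I × J × L)) (hS : ∀ a b c, t a b c ≠ 0 → (bI a, bJ b, bL c) ∈ S)
    {r b : ℕ} (α : I → Fin r → ℤ) (β : J → Fin r → ℤ) (γ : L → Fin r → ℤ)
    (hα : Function.Injective α) (hβ : Function.Injective β) (hγ : Function.Injective γ)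
    (hαb : ∀ i k, |α i k| ≤ b) (hβb : ∀ j k, |β j k| ≤ b)
    (htight : ∀ s ∈ S, ∀ k, α s.1 k + β s.2.1 k + γ s.2.2 k = 0)
    {ρ : ℝ} (c : I × J × L → ℕ) (hcS : ∀ s, s ∉ S → c s = 0) {d : ℕ} (hd : 0 < d)
    (hc : ∑ s, c s = d) (P : I × J × L → ℝ) (hP : ∀ s, P s = (c s : ℝ) / d)
    {W : ℝ} (hW0 : 0 < W)
    (hW : ∀ M : ℕ, 0 < M → ∀ w : Fin (d * M) → I × J × L, (letterCount w = fun s => M * c s) →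
      HasLaserValue ρ (laserBlock bI bJ bL t w) (W ^ (d * M))) :
    HasLaserValue ρ t ((2 : ℝ) ^ (min (shannonEntropy (marginalDist₁ P))
        (min (shannonEntropy (marginalDist₂ P)) (shannonEntropy (marginalDist₃ P))) -
        maxEntropyPenalty S P) * W) := by
  classical
  -- notation
  set E : ℝ := min (shannonEntropy (marginalDist₁ P))
      (min (shannonEntropy (marginalDist₂ P)) (shannonEntropy (marginalDist₃ P))) -
    maxEntropyPenalty S P with hE
  have h2E : 0 < (2 : ℝ) ^ E := Real.rpow_pos_of_pos two_pos _
  have hvs : 0 < (2 : ℝ) ^ E * W := mul_pos h2E hW0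
  refine hasLaserValue_of_forall_lt fun v' hv'0 hv'lt => ?_
  rcases hv'0.eq_or_lt with h0 | hv'pos
  · rw [← h0]; exact hasLaserValue_zero ρ t
  -- `θ = v*/v' > 1`
  set θ : ℝ := (2 : ℝ) ^ E * W / v' with hθ
  have hθ1 : 1 < θ := (one_lt_div hv'pos).2 hv'lt
  have hθ0 : 0 < θ := one_pos.trans hθ1
  have hlogθ : 0 < Real.log θ := Real.log_pos hθ1
  -- constants of the counting bound
  set G : ℕ := Fintype.card (I × J × L) with hG
  set A : ℕ := Fintype.card I + Fintype.card J + Fintype.card L with hA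
  set b' : ℕ := max b 1 with hb'
  have hb'1 : (1 : ℝ) ≤ b' := by exact_mod_cast (le_max_right b 1)
  have hu : 0 ≤ Real.log ((3 * b' : ℕ) : ℝ) := Real.log_natCast_nonneg _
  have hlogG : 0 ≤ Real.log (G : ℝ) := Real.log_natCast_nonneg _
  obtain ⟨M, hM1, hM⟩ := exists_errTerm_le_mul (a := ((2 * G + A : ℕ) : ℝ)) (e := 4)
    (w := Real.log (96 * (b' : ℝ))) (Nat.cast_nonneg _) (by norm_num) hu hlogG hlogθ hd
  have hM0 : 0 < M := by omega
  -- the block value at the words of type `M c`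
  have hWM := hW M hM0
  -- the power `N = d M` and the count vector `Q = M c`
  obtain ⟨N, hN⟩ : ∃ N : ℕ, N = d * M := ⟨_, rfl⟩
  rw [← hN] at hM hWM
  have hN0 : 0 < N := hN ▸ Nat.mul_pos hd hM0
  have hN0' : (0 : ℝ) < N := by exact_mod_cast hN0
  set Q : I × J × L → ℕ := fun s => M * c s with hQ
  have hQS : ∀ s, s ∉ S → Q s = 0 := fun s hs => by simp [hQ, hcS s hs]
  have hQsum : ∑ s, Q s = N := by
    simp only [hQ]; rw [← Finset.mul_sum, hc, hN, mul_comm]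
  have hPQ : ∀ s, P s = (Q s : ℝ) / N := by
    intro s
    rw [hP, hQ, hN]
    push_cast
    have hd0 : (d : ℝ) ≠ 0 := by exact_mod_cast hd.ne'
    have hM0' : (M : ℝ) ≠ 0 := by exact_mod_cast hM0.ne'
    field_simp
  -- the free diagonal of type `Q`
  obtain ⟨Δ, hΔQ, hfree, hcount⟩ := exists_free_diagonal_jointType_card S α β γ hα hβ hγ hαb hβb
    htight hN0 Q hQS hQsum P hPQ
  rw [← hE] at hcount
  -- the junk factor is `≤ θ^N`
  set Jf : ℝ := ((N : ℝ) + 1) ^ (2 * Fintype.card (I × J × L) +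
      (Fintype.card I + Fintype.card J + Fintype.card L)) * (96 * ((max b 1 : ℕ) : ℝ)) *
    Real.exp (4 * √(Real.log ((3 * max b 1 : ℕ) : ℝ) +
      (N : ℝ) * Real.log (Fintype.card (I × J × L) : ℝ))) with hJf
  have hJpos : 0 < Jf := by positivity
  have hJθ : Jf ≤ θ ^ N := by
    rw [← Real.exp_log hJpos, ← Real.exp_log (pow_pos hθ0 N), Real.exp_le_exp, Real.log_pow]
    have hlogJ : Real.log Jf = ((2 * G + A : ℕ) : ℝ) * Real.log ((N : ℝ) + 1) +
        Real.log (96 * (b' : ℝ)) + 4 * √(Real.log ((3 * b' : ℕ) : ℝ) + (N : ℝ) * Real.log (G : ℝ)) := by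
      rw [hJf, Real.log_mul (by positivity) (by positivity), Real.log_mul (by positivity) (by positivity),
        Real.log_exp, Real.log_pow, hG, hA, hb']
    rw [hlogJ, show (N : ℝ) * Real.log (G : ℝ) = Real.log (G : ℝ) * N from mul_comm _ _]
    linarith [hM]
  -- a word of type `Q` and the value of the power
  obtain ⟨w₀, hw₀⟩ := typeClass_nonempty N Q hQsum
  rw [mem_typeClass] at hw₀
  have hblock := hasLaserValue_kroneckerPow_of_free_diagonal_of_block t bI bJ bL S hS Δ hfree w₀
    (fun δ hδ => by rw [hw₀]; exact (Finset.mem_filter.1 (hΔQ hδ)).2) (hWM w₀ hw₀)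
  have hroot := HasLaserValue.of_kroneckerPow (Nat.one_le_iff_ne_zero.2 hN0.ne') hblock
    (by positivity)
  refine hroot.mono hv'0 ?_
  -- `v' ≤ (|Δ| W^N)^{1/N}` because `v'^N θ^N = (2^E W)^N ≤ |Δ| J W^N ≤ |Δ| θ^N W^N`
  have hvθ : v' * θ = (2 : ℝ) ^ E * W := by
    rw [hθ]; field_simp
  have h2EN : ((2 : ℝ) ^ E) ^ N = (2 : ℝ) ^ ((N : ℝ) * E) := by
    rw [← Real.rpow_natCast ((2 : ℝ) ^ E) N, ← Real.rpow_mul zero_le_two, mul_comm]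
  have key : v' ^ N ≤ Δ.card * W ^ N := by
    have h1 : v' ^ N * θ ^ N ≤ (Δ.card * W ^ N) * θ ^ N :=
      calc v' ^ N * θ ^ N = (v' * θ) ^ N := (mul_pow _ _ _).symm
        _ = (2 : ℝ) ^ ((N : ℝ) * E) * W ^ N := by rw [hvθ, mul_pow, h2EN]
        _ ≤ (Δ.card * Jf) * W ^ N := mul_le_mul_of_nonneg_right hcount (pow_nonneg hW0.le N)
        _ ≤ (Δ.card * θ ^ N) * W ^ N := by gcongr
        _ = (Δ.card * W ^ N) * θ ^ N := by ring
    exact le_of_mul_le_mul_right h1 (pow_pos hθ0 N)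
  calc v' = (v' ^ N) ^ ((N : ℝ)⁻¹) := (Real.pow_rpow_inv_natCast hv'0 hN0.ne').symm
    _ ≤ ((Δ.card : ℝ) * W ^ N) ^ ((N : ℝ)⁻¹) :=
        Real.rpow_le_rpow (pow_nonneg hv'0 N) key (inv_nonneg.2 (Nat.cast_nonneg N))

end Rational

/-! ## From rational to real distributions -/

section Approx

variable {K : Type u} [Field K]
variable {ι' κ' μ' : Type*} [Fintype ι'] [Fintype κ'] [Fintype μ']
variable {I J L : Type*} [Fintype I] [Fintype J] [Fintype L] [DecidableEq I] [DecidableEq J]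
  [DecidableEq L]

/-- **Rational approximation with an upper semicontinuous penalty.**  Suppose that for every
count vector `c` supported in `S` with `∑ c = d ≥ 1` a tensor `T` has value
`≥ Φ(c/d) · 2^{−k · max_{D(c/d)} H}` with `Φ` continuous and non-negative and `k ≥ 0`.  Then the same
bound holds at every probability distribution `P` supported in `S` (`c^{(D)}/D → P`
by `exists_counts_approx`; `Φ` is continuous and `max_{D(·)} H` is upper semicontinuous along the
approximation, `maxEntropyGivenMarginals_usc`; the value predicate is closed,
`hasLaserValue_of_forall_lt`).  This is the content of "`P` can be approximated with arbitrary
precision by a probability distribution with rational values" (Le Gall, proof of Thm. 4.1).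
[cite: LeGall2014, Appendix A.3 (first paragraph of the proof)] -/
theorem hasLaserValue_of_rational_approx (T : ι' → κ' → μ' → K) (S : Finset (I × J × L)) {ρ : ℝ}
    (Φ : (I × J × L → ℝ) → ℝ) (hΦ : Continuous Φ) (hΦ0 : ∀ P', 0 ≤ Φ P') {k : ℝ} (hk : 0 ≤ k)
    (h : ∀ (c : I × J × L → ℕ) (d : ℕ), 0 < d → ∑ s, c s = d → (∀ s, s ∉ S → c s = 0) →
      HasLaserValue ρ T (Φ (fun s => (c s : ℝ) / d) *
        (2 : ℝ) ^ (-(k * maxEntropyGivenMarginals S fun s => (c s : ℝ) / d))))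
    (P : I × J × L → ℝ) (hP0 : ∀ s, 0 ≤ P s) (hP1 : ∑ s, P s = 1)
    (hPS : ∀ s, s ∉ S → P s = 0) :
    HasLaserValue ρ T (Φ P * (2 : ℝ) ^ (-(k * maxEntropyGivenMarginals S P))) := by
  classical
  obtain ⟨c, hcsum, hcS, happrox⟩ := exists_counts_approx S P hP0 hP1 hPS
  set Hx : (I × J × L → ℝ) → ℝ := fun P' => maxEntropyGivenMarginals S P' with hHx
  -- the approximants and their bounds
  let PD : ℕ → I × J × L → ℝ := fun D s => (c D s : ℝ) / D
  have hPD : ∀ D, 0 < D → HasLaserValue ρ T (Φ (PD D) * (2 : ℝ) ^ (-(k * Hx (PD D)))) :=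
    fun D hD => h (c D) D hD (hcsum D hD) (hcS D)
  -- `PD → P`
  have hlim : Tendsto PD atTop (𝓝 P) := by
    rw [tendsto_pi_nhds]
    intro s
    rw [tendsto_iff_norm_sub_tendsto_zero]
    refine squeeze_zero_norm' ?_
      (tendsto_const_div_atTop_nhds_zero_nat (Fintype.card (I × J × L) : ℝ))
    filter_upwards [Filter.eventually_gt_atTop 0] with D hD
    rw [norm_norm, Real.norm_eq_abs]
    exact happrox D hD s
  have hlimΦ : Tendsto (fun D => Φ (PD D)) atTop (𝓝 (Φ P)) := (hΦ.tendsto P).comp hlim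
  -- the approximants are distributions supported in `S`, eventually
  have hPDsimp : ∀ᶠ D in atTop, PD D ∈ stdSimplex ℝ (I × J × L) ∧ ∀ x, x ∉ S → PD D x = 0 := by
    filter_upwards [Filter.eventually_gt_atTop 0] with D hD
    refine ⟨⟨fun s => div_nonneg (Nat.cast_nonneg _) (Nat.cast_nonneg _), ?_⟩, fun x hx => ?_⟩
    · simp only [PD]
      rw [← Finset.sum_div, ← Nat.cast_sum, hcsum D hD, div_self]
      exact_mod_cast hD.ne'
    · simp [PD, hcS D x hx]
  refine hasLaserValue_of_forall_lt fun v' hv'0 hv'lt => ?_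
  -- a margin `θ > 0` with `(Φ P − θ) 2^{-k (Hx P + θ)} > v'`
  have hg : ContinuousAt (fun θ : ℝ => (Φ P - θ) * (2 : ℝ) ^ (-(k * (Hx P + θ)))) 0 :=
    ((continuous_const.sub continuous_id).mul ((Real.continuous_const_rpow two_ne_zero).comp
      ((continuous_const.mul (continuous_const.add continuous_id)).neg))).continuousAt
  have hg0 : v' < (fun θ : ℝ => (Φ P - θ) * (2 : ℝ) ^ (-(k * (Hx P + θ)))) 0 := by
    simpa using hv'lt
  obtain ⟨θ, hθ0, hθ⟩ : ∃ θ : ℝ, 0 < θ ∧ v' < (Φ P - θ) * (2 : ℝ) ^ (-(k * (Hx P + θ))) := by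
    have hev := hg.eventually (Ioi_mem_nhds hg0)
    obtain ⟨ε, hε, hball⟩ := Metric.eventually_nhds_iff.1 hev
    refine ⟨ε / 2, by positivity, hball ?_⟩
    rw [Real.dist_eq, sub_zero, abs_of_pos (by positivity)]
    linarith
  -- eventually both `Φ (PD D) ≥ Φ P − θ` and `Hx (PD D) ≤ Hx P + θ`
  have h1 : ∀ᶠ D in atTop, Φ P - θ ≤ Φ (PD D) := by
    have := hlimΦ.eventually (Ioi_mem_nhds (show Φ P - θ < Φ P by linarith))
    exact this.mono fun D hD => hD.le
  have h2 : ∀ᶠ D in atTop, Hx (PD D) ≤ Hx P + θ := maxEntropyGivenMarginals_usc S hPDsimp hlim hθ0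
  obtain ⟨D, hD1, hD2, hD0⟩ := (h1.and (h2.and (Filter.eventually_gt_atTop 0))).exists
  refine (hPD D hD0).mono hv'0 (hθ.le.trans ?_)
  calc (Φ P - θ) * (2 : ℝ) ^ (-(k * (Hx P + θ))) ≤ Φ (PD D) * (2 : ℝ) ^ (-(k * (Hx P + θ))) :=
        mul_le_mul_of_nonneg_right hD1 (Real.rpow_nonneg zero_le_two _)
    _ ≤ Φ (PD D) * (2 : ℝ) ^ (-(k * Hx (PD D))) := by
        refine mul_le_mul_of_nonneg_left (Real.rpow_le_rpow_of_exponent_le one_le_two ?_) (hΦ0 _)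
        have := mul_le_mul_of_nonneg_left hD2 hk
        linarith

end Approx

/-! ## The theorem -/

section Main

variable {K : Type u} [Field K]
variable {ι κ μ : Type*} [Fintype ι] [Fintype κ] [Fintype μ] [DecidableEq ι] [DecidableEq κ]
  [DecidableEq μ]
variable {I J L : Type*} [Fintype I] [Fintype J] [Fintype L] [DecidableEq I] [DecidableEq J]
  [DecidableEq L]

/-- **Le Gall 2014, Thm. 4.1 (the laser method with values and penalty; `min_m H(P_m)` form).**
Let `t : ι → κ → μ → K` be a tensor over a field with block labels `bI, bJ, bL`, let the finite set
`S ⊇ supp_D t` of label triples be `b`-tight (injective `α, β, γ : · → ℤ^r`, `α i + β j + γ l = 0`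
on `S`), and let every component `t(s)`, `s = (i,j,l) ∈ S` (the zero-out of `t` to the block),
have value `V_ρ(t(s)) ≥ v(s) > 0`.  Then for every probability distribution `P` on `S`,
`V_ρ(t) ≥ 2^{min_m H(P_m) − Γ_S(P)} · ∏_{s∈S} v(s)^{P(s)}`, i.e.
`log₂ V_ρ(t) ≥ min_m H(P_m) + ∑_s P(s) log₂ v(s) − Γ_S(P)` with `Γ_S = maxEntropyPenalty S`
(printed: `∑_ℓ H(P_ℓ)/3` in place of `min_m H(P_m)`, for Le Gall's symmetrised value; see the
module docstring). [cite: LeGall2014, Thm. 4.1] -/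
theorem laserMethod_hasLaserValue (t : ι → κ → μ → K) (bI : ι → I) (bJ : κ → J)
    (bL : μ → L) (S : Finset (I × J × L)) (hS : ∀ a b c, t a b c ≠ 0 → (bI a, bJ b, bL c) ∈ S)
    {r b : ℕ} (α : I → Fin r → ℤ) (β : J → Fin r → ℤ) (γ : L → Fin r → ℤ)
    (hα : Function.Injective α) (hβ : Function.Injective β) (hγ : Function.Injective γ)
    (hαb : ∀ i k, |α i k| ≤ b) (hβb : ∀ j k, |β j k| ≤ b)
    (htight : ∀ s ∈ S, ∀ k, α s.1 k + β s.2.1 k + γ s.2.2 k = 0)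
    {ρ : ℝ} (v : I × J × L → ℝ) (hv : ∀ s ∈ S, 0 < v s)
    (hval : ∀ s ∈ S, HasLaserValue ρ (partSubtensor bI bJ bL t {s.1} {s.2.1} {s.2.2}) (v s))
    (P : I × J × L → ℝ) (hP0 : ∀ s, 0 ≤ P s) (hP1 : ∑ s, P s = 1)
    (hPS : ∀ s, s ∉ S → P s = 0) :
    HasLaserValue ρ t ((2 : ℝ) ^ (min (shannonEntropy (marginalDist₁ P))
        (min (shannonEntropy (marginalDist₂ P)) (shannonEntropy (marginalDist₃ P))) -
        maxEntropyPenalty S P) * ∏ s ∈ S, v s ^ P s) := by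
  classical
  -- the functionals
  set Hm : (I × J × L → ℝ) → ℝ := fun P' => min (shannonEntropy (marginalDist₁ P'))
    (min (shannonEntropy (marginalDist₂ P')) (shannonEntropy (marginalDist₃ P'))) with hHm
  set Wf : (I × J × L → ℝ) → ℝ := fun P' => ∏ s ∈ S, v s ^ P' s with hWf
  set Φc : (I × J × L → ℝ) → ℝ := fun P' => (2 : ℝ) ^ (Hm P' + shannonEntropy P') * Wf P' with hΦc
  -- the bound for a distribution `P'` factors as `Φc P' · 2^{-(1 · max H)}`
  have hfactor : ∀ P' : I × J × L → ℝ, (2 : ℝ) ^ (Hm P' - maxEntropyPenalty S P') * Wf P' =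
      Φc P' * (2 : ℝ) ^ (-(1 * maxEntropyGivenMarginals S P')) := by
    intro P'
    simp only [hΦc, maxEntropyPenalty]
    rw [mul_right_comm, ← Real.rpow_add two_pos]
    ring_nf
  have hWf0 : ∀ P', 0 < Wf P' := fun P' => Finset.prod_pos fun s hs => Real.rpow_pos_of_pos (hv s hs) _
  -- continuity and non-negativity of `Φc`
  have hcontΦ : Continuous Φc := by
    have h1 : Continuous Hm := by
      simp only [hHm]
      exact (continuous_shannonEntropy.comp continuous_marginalDist₁).min
        ((continuous_shannonEntropy.comp continuous_marginalDist₂).min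
          (continuous_shannonEntropy.comp continuous_marginalDist₃))
    have h2 : Continuous Wf := by
      simp only [hWf]
      exact continuous_finsetProd _ fun s hs =>
        (Real.continuous_const_rpow (hv s hs).ne').comp (continuous_apply s)
    simp only [hΦc]
    exact ((Real.continuous_const_rpow two_ne_zero).comp (h1.add continuous_shannonEntropy)).mul h2
  have hΦ0 : ∀ P', 0 ≤ Φc P' := fun P' =>
    mul_nonneg (Real.rpow_nonneg zero_le_two _) (hWf0 P').le
  -- the rational case: blocks of type `M c` have value `≥ Wf(c/d)^{dM}` by supermultiplicativity
  have hrat : ∀ (c : I × J × L → ℕ) (d : ℕ), 0 < d → ∑ s, c s = d → (∀ s, s ∉ S → c s = 0) →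
      HasLaserValue ρ t (Φc (fun s => (c s : ℝ) / d) *
        (2 : ℝ) ^ (-(1 * maxEntropyGivenMarginals S fun s => (c s : ℝ) / d))) := by
    intro c d hd hc hcS
    rw [← hfactor]
    refine laserMethod_hasLaserValue_of_blockValue t bI bJ bL S hS α β γ hα hβ hγ hαb hβb htight
      c hcS hd hc _ (fun _ => rfl) (hWf0 _) fun M hM w hw => ?_
    -- the letters of `w` lie in `S`
    have hwS : ∀ q, w q ∈ S := fun q => by
      by_contra h'
      have h0 : letterCount w (w q) = 0 := by rw [hw]; simp [hcS _ h']
      exact (letterCount_pos_of_apply w q).ne' h0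
    have hkp := HasLaserValue.kroneckerPi (fun q => hval _ (hwS q)) (fun q => (hv _ (hwS q)).le)
    rwa [prod_apply_word_eq_pow S v hv c hcS hd w hw] at hkp
  have h := hasLaserValue_of_rational_approx t S Φc hcontΦ hΦ0 zero_le_one hrat P hP0 hP1 hPS
  rwa [← hfactor] at h

/-- **Corollary (Le Gall Thm. 2.2 with Thm. 4.1): the bound on `ω`.**  In the setting of
`laserMethod_hasLaserValue`, if `2^{min_m H(P_m) − Γ_S(P)} ∏_s v(s)^{P(s)} > R̃(t)` (asymptotic rank;
`R̃ ≤ R̲`) and `ρ > 0`, then `ω ≤ ρ`. [cite: LeGall2014, Thm. 2.2 and Thm. 4.1] -/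
theorem omega_le_of_laserMethod (t : ι → κ → μ → K) (bI : ι → I) (bJ : κ → J)
    (bL : μ → L) (S : Finset (I × J × L)) (hS : ∀ a b c, t a b c ≠ 0 → (bI a, bJ b, bL c) ∈ S)
    {r b : ℕ} (α : I → Fin r → ℤ) (β : J → Fin r → ℤ) (γ : L → Fin r → ℤ)
    (hα : Function.Injective α) (hβ : Function.Injective β) (hγ : Function.Injective γ)
    (hαb : ∀ i k, |α i k| ≤ b) (hβb : ∀ j k, |β j k| ≤ b)
    (htight : ∀ s ∈ S, ∀ k, α s.1 k + β s.2.1 k + γ s.2.2 k = 0)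
    {ρ : ℝ} (hρ : 0 < ρ) (v : I × J × L → ℝ) (hv : ∀ s ∈ S, 0 < v s)
    (hval : ∀ s ∈ S, HasLaserValue ρ (partSubtensor bI bJ bL t {s.1} {s.2.1} {s.2.2}) (v s))
    (P : I × J × L → ℝ) (hP0 : ∀ s, 0 ≤ P s) (hP1 : ∑ s, P s = 1)
    (hPS : ∀ s, s ∉ S → P s = 0)
    (hbig : asymptoticRank t < (2 : ℝ) ^ (min (shannonEntropy (marginalDist₁ P))
        (min (shannonEntropy (marginalDist₂ P)) (shannonEntropy (marginalDist₃ P))) -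
        maxEntropyPenalty S P) * ∏ s ∈ S, v s ^ P s) :
    omega K ≤ ρ :=
  omega_le_of_hasLaserValue hρ (laserMethod_hasLaserValue t bI bJ bL S hS α β γ hα hβ hγ hαb hβb
    htight v hv hval P hP0 hP1 hPS) hbig

end Main

end Literature.Computability.AlgebraicComplexity
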